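import Literature.AnabelianGeometry.EtaleTheta.Discharge.Sec5ThetaSubquotientAutLaws
import Literature.AnabelianGeometry.EtaleTheta.ThetaSubquotientOfTemperedQuotient

/-!
# [EtTh] §5: print's `Aut`-subquotient is ONTO `(l·Δ_Θ)_E` at Galois objects as soon as `l·Δ_Θ ⊆ q(Π)`

Mochizuki, *The étale theta function and its Frobenioid-theoretic manifestations*, Publ. RIMS **45** (2009),
§5 p. 327 (PDF p. 101) [cite: MochizukiEtTh2009, §5 p.327 (PDF p.101)]: "`(Π^tp_X)^Θ ⊇ l·Δ_Θ` … for `D ∈ Ob(D)`, these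
subquotients determine subquotients `Aut_D(D) ↠ Aut^Θ_D(D)`; `(l·Δ_Θ)_D ⊆ Aut^Θ_D(D)`"; §5 p. 322 (PDF p. 96): the double
underline case "`A`" `= X̲̲`, i.e. `D = B^temp(Π^tp_X̲̲)⁰` with `Π^tp_X̲̲ ⊊ Π^tp_X`.  abc-iut cell, layer L2, seat abc-iut-L2-t9
(gen 3; unit W2-L2-05 lineage — author of the R2 instance `thetaSubquotientStub`, of print's `Aut`-subquotient
`autPre`/`autProj` and of the Galois-object carrier `lDeltaQEquiv`).  PROOF-ONLY sequel (no `def`) of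
`ThetaSubquotientOfTemperedAut.lean` / `Discharge/Sec5ThetaSubquotientAutLaws.lean` (abc-iut-w4-d042) /
`ThetaSubquotientOfTemperedQuotient.lean`; nothing landed is edited or restated.

WHY.  The landed surjectivity theorems (`autProj_surjective_of_normal`, abc-iut-w4-d042's `autProj_surjective_of_isGaloisObj`)
ask the parameter `q : Π → Q` to be ONTO `Q = (Π^tp_X)^Θ` — true in the single underline case `Π = Π^tp_X`
(`q = Π^tp_X ↠ (Π^tp_X)^Θ`), false in the double underline case `Π = Π^tp_X̲̲` (`q = (Π^tp_X ↠ (Π^tp_X)^Θ)|_{Π^tp_X̲̲}`, the base of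
§5's data, cf. abc-iut-L2-t9's `ThetaSubquotientOfThetaSetting.lean` `ofSettingSub`).  The proofs use surjectivity only to lift
elements of `L = ι(Λ) = l·Δ_Θ` to `Π`; so `L ⊆ q(Π)` suffices — which is print's "`(Π^tp_X̲̲)^Θ ⊇ l·Δ_Θ`" in the double underline
case.

WHAT IS PROVED (`q : Π → Q`, `ι : Λ → Q` with normal image `L`, hypothesis `hL : L ≤ q(Π)`).
* `autProj_surjective_of_normal_of_range_le` — at a connected object with a point of NORMAL stabiliser, `autProj` is onto
  `(l·Δ_Θ)_E` (generalises `autProj_surjective_of_normal`, recovered as `…_of_surjective'`);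
* `autProj_surjective_of_isGaloisObj_of_range_le` — the same at every Galois object of `B^temp(Π)` ([SemiAnbd] Def. 3.1 (iv);
  abc-iut-w5-d013's base point `galoisBase`), `Π` tempered (generalises abc-iut-w4-d042's `autProj_surjective_of_isGaloisObj`);
* `autProj_Q_surjective_of_range_le` — the same at the Galois objects `Π/N` (abc-iut-L3's `BTemp.Q`), where the carrier is
  `Λ/ι⁻¹(q(N) ∩ L)` explicitly — abc-iut-L2-t9's gen-2 `autProj_Q_surjective` (kept back at the time, cf. the module doc of
  `ThetaSubquotientOfTemperedQuotient.lean`) in its sharp form;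
* `range_autProj_evalEquiv_eq_top_of_range_le` (bookkeeping): composed with evaluation at the point, the image is everything.

HONEST FRAMING: generic group/temperoid-theoretic facts about abc-iut-L2-t9's carriers; `Π`, `q`, `ι` are parameters; nothing is
asserted about [EtTh]'s curves; [EtTh] is refereed and nothing here bears on [IUTchIII] Cor. 3.12 — no side is taken;
typed ≠ proved.
-/

noncomputable section

namespace Literature.AnabelianGeometry.EtaleTheta

namespace ThetaSubquotient

open CategoryTheory Literature.AlgebraicGeometry.Frobenioids Literature.AnabelianGeometry.SemiGraphs
open Literature.AlgebraicGeometry.Frobenioids.QuasiTemperoid (stabilizerSubgroup)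

universe u v w

variable {G : Type u} [Group G] [TopologicalSpace G] {Q : Type v} [Group Q] {Λ : Type w} [CommGroup Λ]
  (q : G →* Q) (ι : Λ →* Q) [ι.range.Normal]

/-! ### Connected objects with a point of normal stabiliser -/

section Normal

variable {E : BTemp G}

/-- **`autProj` is onto `(l·Δ_Θ)_E` at a point of NORMAL stabiliser as soon as `L ⊆ q(Π)`**: every class in
`Λ/J(Stab x)` is `[a]`, `ι a = q n` for some `n ∈ Π` (this is where `hL` enters), and right multiplication by `n` on
`E ≅ Π/Stab x` is an automorphism "given by `l·Δ_Θ`" mapping to it (abc-iut-L2-t9's `exists_aut_apply_eq`,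
`mem_autPre_of_apply_eq`, `evalAt_autProj`). [cite: MochizukiEtTh2009, §5 p.327 (PDF p.101)] -/
theorem autProj_surjective_of_normal_of_range_le (hE : IsConnectedObj E) (hL : ι.range ≤ q.range)
    (x : E.obj.V) (hN : (stabilizerSubgroup E x).Normal) :
    Function.Surjective (autProj q ι E) := by
  intro c
  obtain ⟨c₀, rfl⟩ := (evalEquiv q ι hE x).symm.surjective c
  induction c₀ using QuotientGroup.induction_on with
  | H a =>
    obtain ⟨n, hn⟩ := hL (mem_range_self ι a)
    obtain ⟨σ, hσ⟩ := exists_aut_apply_eq hE x hN n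
    have hmem : σ ∈ autPre q ι E := mem_autPre_of_apply_eq q ι hE x (hn ▸ mem_range_self ι a) hσ
    refine ⟨⟨σ, hmem⟩, ?_⟩
    apply (evalEquiv q ι hE x).injective
    rw [MulEquiv.apply_symm_apply, evalEquiv_apply]
    exact evalAt_autProj q ι E ⟨σ, hmem⟩ x n a hn.symm hσ

/-- The landed `autProj_surjective_of_normal` is the case `q` onto (`L ⊆ Q = q(Π)`).
[cite: MochizukiEtTh2009, §5 p.327 (PDF p.101)] -/
theorem autProj_surjective_of_normal_of_surjective' (hE : IsConnectedObj E) (hq : Function.Surjective q)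
    (x : E.obj.V) (hN : (stabilizerSubgroup E x).Normal) : Function.Surjective (autProj q ι E) :=
  autProj_surjective_of_normal_of_range_le q ι hE (fun y _ => hq y) x hN

/-- Bookkeeping: with `L ⊆ q(Π)`, through the evaluation isomorphism at `x` the image of `autPre E` is all of
`Λ/J(Stab x)`. [cite: MochizukiEtTh2009, §5 p.327 (PDF p.101)] -/
theorem range_autProj_evalEquiv_eq_top_of_range_le (hE : IsConnectedObj E) (hL : ι.range ≤ q.range)
    (x : E.obj.V) (hN : (stabilizerSubgroup E x).Normal) :
    ((evalEquiv q ι hE x).toMonoidHom.comp (autProj q ι E)).range = ⊤ := by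
  rw [MonoidHom.range_eq_top]
  exact (evalEquiv q ι hE x).surjective.comp (autProj_surjective_of_normal_of_range_le q ι hE hL x hN)

end Normal

/-! ### Galois objects of `B^temp(Π)` -/

section Galois

variable [IsTopologicalGroup G]

/-- **At every Galois object of `B^temp(Π)` ([SemiAnbd] Def. 3.1 (iv)), `autProj` is onto `(l·Δ_Θ)_A` as soon as
`L ⊆ q(Π)`** (abc-iut-w5-d013's base point `galoisBase`, whose stabiliser is the open normal subgroup `N_A`;
generalises abc-iut-w4-d042's `autProj_surjective_of_isGaloisObj`). [cite: MochizukiEtTh2009, §5 p.327 (PDF p.101)] -/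
theorem autProj_surjective_of_isGaloisObj_of_range_le (hG : IsTempered G) (A : BTemp G) (hA : IsGaloisObj A)
    (hL : ι.range ≤ q.range) : Function.Surjective (autProj q ι A) := by
  refine autProj_surjective_of_normal_of_range_le q ι hA.1 hL (GaloisObjects.galoisBase hG A hA) ?_
  have h : stabilizerSubgroup A (GaloisObjects.galoisBase hG A hA) =
      (GaloisObjects.galoisQuot hG A hA).toSubgroup := by
    ext g
    rw [QuasiTemperoid.mem_stabilizerSubgroup_iff, ← GaloisObjects.mem_ker_galoisSurjOf_iff hG A hA g,
      GaloisObjects.ker_galoisSurjOf]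
  rw [h]
  infer_instance

/-- **At the Galois objects `Π/N` (`N` open normal; abc-iut-L3's `BTemp.Q`) `autProj` is onto
`(l·Δ_Θ)_{Π/N} ≅ Λ/ι⁻¹(q(N) ∩ L)` as soon as `L ⊆ q(Π)`** — print's "`(l·Δ_Θ)_D ⊆ Aut^Θ_D(D)`", the image `L·q(N)/q(N)` of
the automorphisms given by `l·Δ_Θ`, reached entirely from `Aut_D(Π/N) = Π/N` (stabilisers of `Π/N` are all `N`,
`stabilizerSubgroup_Q`). [cite: MochizukiEtTh2009, §5 p.327 (PDF p.101)] -/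
theorem autProj_Q_surjective_of_range_le (hG : IsTempered G) (hL : ι.range ≤ q.range)
    (N : OpenNormalSubgroup G) :
    Function.Surjective (autProj q ι (BTemp.Q hG N)) :=
  autProj_surjective_of_normal_of_range_le q ι (isConnectedObj_Q hG N) hL ((1 : G) : G ⧸ N.toSubgroup)
    (by rw [stabilizerSubgroup_Q]; infer_instance)

/-- Hence, composed with abc-iut-L2-t9's explicit carrier `lDeltaQEquiv` (for `q` onto): every class of
`Λ ⧸ ι⁻¹(q(N) ∩ L)` is the image of an automorphism of `Π/N` given by `l·Δ_Θ`.
[cite: MochizukiEtTh2009, §5 p.327 (PDF p.101)] -/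
theorem lDeltaQEquiv_comp_autProj_surjective (hG : IsTempered G) (hq : Function.Surjective q)
    (N : OpenNormalSubgroup G) :
    Function.Surjective ((lDeltaQEquiv hG q ι hq N).toMonoidHom.comp (autProj q ι (BTemp.Q hG N))) :=
  (lDeltaQEquiv hG q ι hq N).surjective.comp (autProj_Q_surjective_of_range_le q ι hG (fun y _ => hq y) N)

end Galois

end ThetaSubquotient

end Literature.AnabelianGeometry.EtaleTheta

end
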